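import Mathlib

/-!
# `NoHeavyLowerTail` (crux stmt-CriticalPhenomena-4575), Sahi programme (prim-master-conj gen 42): the LATIN KERNEL `κ_d` of Sahi's
# third functional in EVERY dimension `d` — definitions, slot symmetry, the first-point (charge) form and the link/antipode calculus

Support file (`--supports stmt-CriticalPhenomena-4575`).  Nothing here is specific to percolation; nothing is asserted about the crux.
Memo: `run/shared/lean/prim/prim-l12/FROM-prim-master-conj-g41-DESCENT.md` §0–§1 (paper), §9 (this Lean plan); POINTWISE §42–§43.

## Setting

`Pt ι = ι → Fin 3` is the grid `[3]^d` (`d = |ι|`, product order).  A LATIN TRIPLE of the grid is a triple of points carrying, on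
every axis, the three levels `0,1,2` in some order; it is `(ρ·0, ρ·1, ρ·2)` for a unique `ρ : ι → Perm (Fin 3)` (`lpt ρ j = fun i => ρ i j`).
For finite sets `a, b, c` of points the kernel is
  `κ(a,b,c) = Σ_{Latin (x,y,z)} G`,  `G = 2[x∈abc] − [x∈a][y∈bc] − [x∈b][y∈ac] − [x∈c][y∈ab] + [x∈a][y∈b][z∈c]`
(`G`, `kappa`; integers).  By the full-polarisation identity of gen 40 (`…SahiThreeChainsBridgePolar`, there for `d = 3`; for all `d`
in `…SahiLatinBridge`), `κ_d ≥ 0` on all triples of UP-sets of `[3]^d` ("FBP(3,d)") implies Sahi's `E₃(f,g,h) ≥ 0` for nonneg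
monotone `f,g,h` on every product of `d` finite chains with every product probability measure (indeed every joint Bernstein
coefficient of `E₃` is then `≥ 0`).

## Contents (everything proved; axioms standard)

* `ind`, `G`, `lpt`, `kappa`; `sum_lpt_perm` (re-indexing the Latin sum by a permutation of the three points) and the slot
  symmetries `kappa_swap12`, `kappa_swap23`, `kappa_swap13`;
* the LINK `link u = {y : ∀ i, y i ≠ u i}` (`≅ {0,1}^d`), `card_link = 2^d`, the Latin completion `anti u y = −(u+y)` (coordinatewise
  in `Fin 3`: the third level), `anti_anti`, `anti_mem_link`;
* `sum_lperm_eq_sum_link` — **a Latin sum is a double sum**: `Σ_ρ F(ρ·0,ρ·1,ρ·2) = Σ_x Σ_{y ∈ link x} F(x, y, anti x y)`;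
* the CHARGE `Phi b c u` and the **first-point form** `kappa_eq_sum_Phi : κ(a,b,c) = Σ_{u∈a} Φ_{bc}(u)`, hence trilinearity in the
  form used by the descent: `kappa_insert` (`κ(a ∪ {m}) = κ(a) + Φ(m)`, `m ∉ a`) and `kappa_eq_kappa_erase_add` (`m ∈ a`);
* the counting functions `N s u = |s ∩ link u|`, `Lam b c u = #{y ∈ link u : y ∈ b, anti u y ∈ c}` and the **closed form**
  `Phi_eq : Φ_{bc}(u) = 2^{d+1}[u∈b∩c] − N_{b∩c}(u) − [u∈c]N_b(u) − [u∈b]N_c(u) + Λ_{bc}(u)`.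
The move lemmas R/A (signs of `Φ`), the descent to terminal triples and the bridge to `SahiPositive` are the companion files
`…SahiLatinMoves`, `…SahiLatinDescent`, `…SahiLatinBridge`.
-/

namespace Summit.CriticalPhenomena.PercolationContinuityZ3.Theorems.SahiLatin

open Finset

variable {ι : Type*} [Fintype ι] [DecidableEq ι]

/-! ## Points, indicators, the integrand and the kernel -/

/-- The grid `[3]^ι`: points are functions `ι → Fin 3`, ordered coordinatewise. [this work] -/
abbrev Pt (ι : Type*) := ι → Fin 3

/-- Index set of the Latin triples: one permutation of the three levels per axis. [this work] -/
abbrev LPerm (ι : Type*) := ι → Equiv.Perm (Fin 3)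

/-- The `j`-th point of the Latin triple indexed by `ρ`: `i ↦ ρ i j`. [this work] -/
def lpt (ρ : LPerm ι) (j : Fin 3) : Pt ι := fun i => ρ i j

/-- Integer indicator of a finite set. [this work] -/
def ind {β : Type*} [DecidableEq β] (s : Finset β) (x : β) : ℤ := if x ∈ s then 1 else 0

/-- `ind` unfolds. [this work] -/
theorem ind_apply {β : Type*} [DecidableEq β] (s : Finset β) (x : β) : ind s x = if x ∈ s then 1 else 0 := rfl

/-- `ind s x = 1` on `s`. [this work] -/
@[simp] theorem ind_of_mem {β : Type*} [DecidableEq β] {s : Finset β} {x : β} (h : x ∈ s) : ind s x = 1 := by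
  simp [ind, h]

/-- `ind s x = 0` off `s`. [this work] -/
@[simp] theorem ind_of_not_mem {β : Type*} [DecidableEq β] {s : Finset β} {x : β} (h : x ∉ s) : ind s x = 0 := by
  simp [ind, h]

/-- `ind (s ∩ t) = ind s * ind t`. [this work] -/
theorem ind_inter {β : Type*} [DecidableEq β] (s t : Finset β) (x : β) : ind (s ∩ t) x = ind s x * ind t x := by
  by_cases hs : x ∈ s <;> by_cases ht : x ∈ t <;> simp [ind, hs, ht]

/-- Sahi's order-3 integrand on three independent copies:
`G = 2[x∈abc] − [x∈a][y∈bc] − [x∈b][y∈ac] − [x∈c][y∈ab] + [x∈a][y∈b][z∈c]`. [this work] -/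
def G {β : Type*} [DecidableEq β] (a b c : Finset β) (x y z : β) : ℤ :=
  2 * (ind a x * ind b x * ind c x) - ind a x * (ind b y * ind c y) - ind b x * (ind a y * ind c y)
    - ind c x * (ind a y * ind b y) + ind a x * ind b y * ind c z

/-- **The Latin kernel** `κ(a,b,c) = Σ_{Latin triples (x,y,z)} G_{abc}(x,y,z)` of three finite subsets of the grid `[3]^ι`. [this work] -/
def kappa (a b c : Finset (Pt ι)) : ℤ := ∑ ρ : LPerm ι, G a b c (lpt ρ 0) (lpt ρ 1) (lpt ρ 2)

/-! ## Re-indexing by a permutation of the three points; slot symmetry -/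

/-- The constant family `i ↦ τ`, an element of the group `LPerm ι`. [this work] -/
def cst (τ : Equiv.Perm (Fin 3)) : LPerm ι := fun _ => τ

omit [Fintype ι] [DecidableEq ι] in
/-- Points of `ρ · cst τ` are the `τ`-permuted points of `ρ`. [this work] -/
theorem lpt_mul_cst (ρ : LPerm ι) (τ : Equiv.Perm (Fin 3)) (j : Fin 3) : lpt (ρ * cst τ) j = lpt ρ (τ j) := by
  funext i; simp [lpt, cst, Pi.mul_apply, Equiv.Perm.mul_apply]

/-- Re-indexing a Latin sum by a permutation `τ` of the three points. [this work] -/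
theorem sum_lpt_perm (F : Pt ι → Pt ι → Pt ι → ℤ) (τ : Equiv.Perm (Fin 3)) :
    ∑ ρ : LPerm ι, F (lpt ρ (τ 0)) (lpt ρ (τ 1)) (lpt ρ (τ 2)) = ∑ ρ : LPerm ι, F (lpt ρ 0) (lpt ρ 1) (lpt ρ 2) := by
  rw [← Equiv.sum_comp (Equiv.mulRight (cst (ι := ι) τ)) (fun ρ => F (lpt ρ 0) (lpt ρ 1) (lpt ρ 2))]
  simp only [Equiv.coe_mulRight, lpt_mul_cst]

/-- Swapping the first two points. [this work] -/
theorem sum_lpt_swap01 (F : Pt ι → Pt ι → Pt ι → ℤ) :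
    ∑ ρ : LPerm ι, F (lpt ρ 1) (lpt ρ 0) (lpt ρ 2) = ∑ ρ : LPerm ι, F (lpt ρ 0) (lpt ρ 1) (lpt ρ 2) := by
  have h := sum_lpt_perm F (Equiv.swap 0 1)
  simpa [Equiv.swap_apply_left, Equiv.swap_apply_right, Equiv.swap_apply_of_ne_of_ne] using h

/-- Swapping the last two points. [this work] -/
theorem sum_lpt_swap12 (F : Pt ι → Pt ι → Pt ι → ℤ) :
    ∑ ρ : LPerm ι, F (lpt ρ 0) (lpt ρ 2) (lpt ρ 1) = ∑ ρ : LPerm ι, F (lpt ρ 0) (lpt ρ 1) (lpt ρ 2) := by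
  have h := sum_lpt_perm F (Equiv.swap 1 2)
  simpa [Equiv.swap_apply_left, Equiv.swap_apply_right, Equiv.swap_apply_of_ne_of_ne] using h

/-- `κ` is symmetric in its first two arguments. [this work] -/
theorem kappa_swap12 (a b c : Finset (Pt ι)) : kappa a b c = kappa b a c := by
  have h : ∑ ρ : LPerm ι, ind a (lpt ρ 0) * ind b (lpt ρ 1) * ind c (lpt ρ 2) =
      ∑ ρ : LPerm ι, ind b (lpt ρ 0) * ind a (lpt ρ 1) * ind c (lpt ρ 2) := by
    rw [← sum_lpt_swap01 (fun x y z => ind b x * ind a y * ind c z)]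
    exact sum_congr rfl fun ρ _ => by ring
  have e : ∀ ρ : LPerm ι, G a b c (lpt ρ 0) (lpt ρ 1) (lpt ρ 2) - G b a c (lpt ρ 0) (lpt ρ 1) (lpt ρ 2) =
      ind a (lpt ρ 0) * ind b (lpt ρ 1) * ind c (lpt ρ 2) - ind b (lpt ρ 0) * ind a (lpt ρ 1) * ind c (lpt ρ 2) :=
    fun ρ => by simp only [G]; ring
  have h0 : kappa a b c - kappa b a c = 0 := by
    unfold kappa
    rw [← sum_sub_distrib, sum_congr rfl (fun ρ _ => e ρ), sum_sub_distrib, h, sub_self]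
  exact sub_eq_zero.mp h0

/-- `κ` is symmetric in its last two arguments. [this work] -/
theorem kappa_swap23 (a b c : Finset (Pt ι)) : kappa a b c = kappa a c b := by
  have h : ∑ ρ : LPerm ι, ind a (lpt ρ 0) * ind c (lpt ρ 1) * ind b (lpt ρ 2) =
      ∑ ρ : LPerm ι, ind a (lpt ρ 0) * ind b (lpt ρ 1) * ind c (lpt ρ 2) := by
    rw [← sum_lpt_swap12 (fun x y z => ind a x * ind b y * ind c z)]
    exact sum_congr rfl fun ρ _ => by ring
  have e : ∀ ρ : LPerm ι, G a b c (lpt ρ 0) (lpt ρ 1) (lpt ρ 2) - G a c b (lpt ρ 0) (lpt ρ 1) (lpt ρ 2) =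
      ind a (lpt ρ 0) * ind b (lpt ρ 1) * ind c (lpt ρ 2) - ind a (lpt ρ 0) * ind c (lpt ρ 1) * ind b (lpt ρ 2) :=
    fun ρ => by simp only [G]; ring
  have h0 : kappa a b c - kappa a c b = 0 := by
    unfold kappa
    rw [← sum_sub_distrib, sum_congr rfl (fun ρ _ => e ρ), sum_sub_distrib, h, sub_self]
  exact sub_eq_zero.mp h0

/-- `κ` is symmetric in its outer arguments. [this work] -/
theorem kappa_swap13 (a b c : Finset (Pt ι)) : kappa a b c = kappa c b a := by
  rw [kappa_swap12, kappa_swap23, kappa_swap12]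

/-! ## The link of a point and the Latin completion -/

/-- The LINK of `u`: the points differing from `u` in every coordinate (a copy of the cube `{0,1}^ι`). [this work] -/
def link (u : Pt ι) : Finset (Pt ι) := Fintype.piFinset fun i => (univ : Finset (Fin 3)).erase (u i)

/-- Membership in the link. [this work] -/
@[simp] theorem mem_link {u y : Pt ι} : y ∈ link u ↔ ∀ i, y i ≠ u i := by
  simp [link, Fintype.mem_piFinset]

/-- The link has `2^d` points. [this work] -/
theorem card_link (u : Pt ι) : (link u).card = 2 ^ Fintype.card ι := by
  rw [link, Fintype.card_piFinset]
  simp [Finset.card_erase_of_mem, Finset.prod_const, Finset.card_univ]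

/-- The Latin completion of `(u, y)`: coordinatewise the third level, `−(u i + y i)` in `Fin 3`. [this work] -/
def anti (u y : Pt ι) : Pt ι := fun i => -(u i + y i)

/-- Third-level arithmetic in `Fin 3` (finite check). [this work] -/
theorem neg_add_neg_add : ∀ a b : Fin 3, -(a + -(a + b)) = b := by decide

omit [Fintype ι] [DecidableEq ι] in
/-- `anti u` is an involution. [this work] -/
@[simp] theorem anti_anti (u y : Pt ι) : anti u (anti u y) = y := by
  funext i; exact neg_add_neg_add (u i) (y i)

omit [Fintype ι] [DecidableEq ι] in
/-- `anti u` is injective. [this work] -/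
theorem anti_injective (u : Pt ι) : Function.Injective (anti u) := fun y y' h => by
  rw [← anti_anti u y, h, anti_anti]

/-- Third levels in `Fin 3` (finite check). [this work] -/
theorem third_ne (a b : Fin 3) (h : b ≠ a) : -(a + b) ≠ a ∧ -(a + b) ≠ b := by
  revert a b; decide

/-- The completion of a link point is a link point. [this work] -/
theorem anti_mem_link {u y : Pt ι} (hy : y ∈ link u) : anti u y ∈ link u := by
  rw [mem_link] at hy ⊢
  intro i
  exact (third_ne (u i) (y i) (hy i)).1

/-- The completion of a link point differs from it everywhere. [this work] -/
theorem anti_ne {u y : Pt ι} (hy : y ∈ link u) (i : ι) : anti u y i ≠ y i := by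
  rw [mem_link] at hy
  exact (third_ne (u i) (y i) (hy i)).2

/-! ## A Latin sum is a double sum over (first point, link point) -/

/-- A permutation of `Fin 3` is determined by its values at `0` and `1` (finite check). [this work] -/
theorem perm_eq_of_apply01 : ∀ σ τ : Equiv.Perm (Fin 3), σ 0 = τ 0 → σ 1 = τ 1 → σ = τ := by decide

/-- Its value at `2` is the third level (finite check). [this work] -/
theorem perm_apply_two : ∀ σ : Equiv.Perm (Fin 3), σ 2 = -(σ 0 + σ 1) := by decide

/-- Every ordered pair of distinct levels extends to a permutation (finite check). [this work] -/
theorem exists_perm_apply01 : ∀ a b : Fin 3, b ≠ a → ∃ σ : Equiv.Perm (Fin 3), σ 0 = a ∧ σ 1 = b := by decide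

omit [Fintype ι] [DecidableEq ι] in
/-- The third point of a Latin triple is the completion of the first two. [this work] -/
theorem lpt_two (ρ : LPerm ι) : lpt ρ 2 = anti (lpt ρ 0) (lpt ρ 1) := by
  funext i; simp only [lpt, anti]; exact perm_apply_two (ρ i)

/-- The second point of a Latin triple lies in the link of the first. [this work] -/
theorem lpt_one_mem_link (ρ : LPerm ι) : lpt ρ 1 ∈ link (lpt ρ 0) := by
  rw [mem_link]; intro i
  simp only [lpt]
  exact fun h => by have := (ρ i).injective h; exact absurd this (by decide)

/-- The map `ρ ↦ (ρ·0, ρ·1)`. [this work] -/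
def pair01 (ρ : LPerm ι) : Pt ι × Pt ι := (lpt ρ 0, lpt ρ 1)

omit [Fintype ι] [DecidableEq ι] in
/-- `pair01` is injective. [this work] -/
theorem pair01_injective : Function.Injective (pair01 (ι := ι)) := by
  intro ρ ρ' h
  simp only [pair01, Prod.mk.injEq] at h
  funext i
  exact perm_eq_of_apply01 _ _ (congrFun h.1 i) (congrFun h.2 i)

/-- The image of `pair01` is the set of pairs `(x, y)` with `y` in the link of `x`. [this work] -/
theorem image_pair01 : (univ : Finset (LPerm ι)).image pair01 = univ.filter fun p : Pt ι × Pt ι => p.2 ∈ link p.1 := by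
  ext ⟨x, y⟩
  simp only [mem_image, mem_univ, true_and, mem_filter, pair01, Prod.mk.injEq]
  constructor
  · rintro ⟨ρ, rfl, rfl⟩
    exact lpt_one_mem_link ρ
  · intro hy
    rw [mem_link] at hy
    choose σ hσ using fun i => exists_perm_apply01 (x i) (y i) (hy i)
    exact ⟨σ, funext fun i => (hσ i).1, funext fun i => (hσ i).2⟩

/-- **A Latin sum is a double sum**: `Σ_ρ F(ρ·0, ρ·1, ρ·2) = Σ_x Σ_{y ∈ link x} F(x, y, anti x y)`. [this work] -/
theorem sum_lperm_eq_sum_link (F : Pt ι → Pt ι → Pt ι → ℤ) :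
    ∑ ρ : LPerm ι, F (lpt ρ 0) (lpt ρ 1) (lpt ρ 2) = ∑ x : Pt ι, ∑ y ∈ link x, F x y (anti x y) := by
  have h2 : ∑ p ∈ (univ : Finset (LPerm ι)).image pair01, F p.1 p.2 (anti p.1 p.2) =
      ∑ ρ : LPerm ι, F (lpt ρ 0) (lpt ρ 1) (lpt ρ 2) := by
    rw [sum_image (fun ρ _ ρ' _ h => pair01_injective h)]
    refine sum_congr rfl fun ρ _ => ?_
    simp only [pair01, lpt_two]
  rw [← h2, image_pair01, sum_filter, ← univ_product_univ, sum_product]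
  refine sum_congr rfl fun x _ => ?_
  dsimp only
  rw [sum_ite_mem, univ_inter]

/-! ## The charge and the first-point form -/

/-- The CHARGE `Φ_{bc}(u)`: the coefficient of `[u ∈ a]` in `κ(a,b,c)` —
`Σ_{y ∈ link u} (2[u∈b][u∈c] − [y∈b][y∈c] − [u∈c][y∈b] − [u∈b][y∈c] + [y∈b][anti u y ∈ c])`. [this work] -/
def Phi (b c : Finset (Pt ι)) (u : Pt ι) : ℤ :=
  ∑ y ∈ link u, (2 * (ind b u * ind c u) - ind b y * ind c y - ind c u * ind b y - ind b u * ind c y + ind b y * ind c (anti u y))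

/-- **First-point form (trilinearity)**: `κ(a,b,c) = Σ_{u ∈ a} Φ_{bc}(u)`. [this work] -/
theorem kappa_eq_sum_Phi (a b c : Finset (Pt ι)) : kappa a b c = ∑ u ∈ a, Phi b c u := by
  -- bring `a` to the first point in the two terms where it sits at the second point
  have h3 : ∑ ρ : LPerm ι, ind b (lpt ρ 0) * (ind a (lpt ρ 1) * ind c (lpt ρ 1)) =
      ∑ ρ : LPerm ι, ind a (lpt ρ 0) * (ind c (lpt ρ 0) * ind b (lpt ρ 1)) := by
    rw [← sum_lpt_swap01 (fun x y _ => ind b x * (ind a y * ind c y))]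
    exact sum_congr rfl fun ρ _ => by ring
  have h4 : ∑ ρ : LPerm ι, ind c (lpt ρ 0) * (ind a (lpt ρ 1) * ind b (lpt ρ 1)) =
      ∑ ρ : LPerm ι, ind a (lpt ρ 0) * (ind b (lpt ρ 0) * ind c (lpt ρ 1)) := by
    rw [← sum_lpt_swap01 (fun x y _ => ind c x * (ind a y * ind b y))]
    exact sum_congr rfl fun ρ _ => by ring
  have step1 : kappa a b c = ∑ ρ : LPerm ι, ind a (lpt ρ 0) *
      (2 * (ind b (lpt ρ 0) * ind c (lpt ρ 0)) - ind b (lpt ρ 1) * ind c (lpt ρ 1)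
        - ind c (lpt ρ 0) * ind b (lpt ρ 1) - ind b (lpt ρ 0) * ind c (lpt ρ 1) + ind b (lpt ρ 1) * ind c (lpt ρ 2)) := by
    unfold kappa
    simp only [G]
    rw [sum_add_distrib, sum_sub_distrib, sum_sub_distrib, sum_sub_distrib, h3, h4, ← sum_sub_distrib, ← sum_sub_distrib,
      ← sum_sub_distrib, ← sum_add_distrib]
    exact sum_congr rfl fun ρ _ => by ring
  rw [step1, sum_lperm_eq_sum_link (fun x y z => ind a x * (2 * (ind b x * ind c x) - ind b y * ind c y - ind c x * ind b y
      - ind b x * ind c y + ind b y * ind c z))]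
  -- `Σ_x [x∈a] · P(x) = Σ_{x ∈ a} P(x)`
  rw [← sum_filter_add_sum_filter_not univ (fun u => u ∈ a)]
  have hin : ∑ u ∈ univ.filter (fun u => u ∈ a), ∑ y ∈ link u, ind a u * (2 * (ind b u * ind c u) - ind b y * ind c y
      - ind c u * ind b y - ind b u * ind c y + ind b y * ind c (anti u y)) = ∑ u ∈ a, Phi b c u := by
    rw [filter_univ_mem]
    refine sum_congr rfl fun u hu => ?_
    simp only [ind_of_mem hu, one_mul, Phi]
  have hout : ∑ u ∈ univ.filter (fun u => ¬ u ∈ a), ∑ y ∈ link u, ind a u * (2 * (ind b u * ind c u) - ind b y * ind c y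
      - ind c u * ind b y - ind b u * ind c y + ind b y * ind c (anti u y)) = 0 :=
    sum_eq_zero fun u hu => by
      rw [mem_filter] at hu
      simp [ind_of_not_mem hu.2]
  rw [hin, hout, add_zero]

/-- Trilinearity as used by the descent: adding a point `m ∉ a` changes `κ` by the charge `Φ_{bc}(m)`. [this work] -/
theorem kappa_insert {a : Finset (Pt ι)} {m : Pt ι} (hm : m ∉ a) (b c : Finset (Pt ι)) :
    kappa (insert m a) b c = kappa a b c + Phi b c m := by
  rw [kappa_eq_sum_Phi, kappa_eq_sum_Phi, sum_insert hm, add_comm]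

/-- Trilinearity as used by the descent: `κ(a) = κ(a ∖ {m}) + Φ_{bc}(m)` for `m ∈ a`. [this work] -/
theorem kappa_eq_kappa_erase_add {a : Finset (Pt ι)} {m : Pt ι} (hm : m ∈ a) (b c : Finset (Pt ι)) :
    kappa a b c = kappa (a.erase m) b c + Phi b c m := by
  conv_lhs => rw [← insert_erase hm]
  exact kappa_insert (notMem_erase m a) b c

/-! ## Counting functions on the link and the closed form of the charge -/

/-- `N_s(u) = |s ∩ link u|`. [this work] -/
def N (s : Finset (Pt ι)) (u : Pt ι) : ℕ := ((link u).filter fun y => y ∈ s).card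

/-- `Λ_{bc}(u) = #{y ∈ link u : y ∈ b, anti u y ∈ c}` (link points of `b` whose antipode lies in `c`). [this work] -/
def Lam (b c : Finset (Pt ι)) (u : Pt ι) : ℕ := ((link u).filter fun y => y ∈ b ∧ anti u y ∈ c).card

/-- `N_s(u) ≤ 2^d`. [this work] -/
theorem N_le (s : Finset (Pt ι)) (u : Pt ι) : N s u ≤ 2 ^ Fintype.card ι := by
  rw [N, ← card_link u]; exact card_filter_le _ _

/-- `N_{b∩c}` in filter form. [this work] -/
theorem N_inter (b c : Finset (Pt ι)) (u : Pt ι) : N (b ∩ c) u = ((link u).filter fun y => y ∈ b ∧ y ∈ c).card := by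
  simp only [N, mem_inter]

/-- **Closed form of the charge**:
`Φ_{bc}(u) = 2^{d+1}[u∈b][u∈c] − N_{b∩c}(u) − [u∈c]N_b(u) − [u∈b]N_c(u) + Λ_{bc}(u)`. [this work] -/
theorem Phi_eq (b c : Finset (Pt ι)) (u : Pt ι) :
    Phi b c u = 2 ^ (Fintype.card ι + 1) * (ind b u * ind c u) - (N (b ∩ c) u : ℤ) - ind c u * (N b u : ℤ)
      - ind b u * (N c u : ℤ) + (Lam b c u : ℤ) := by
  have hNbc : ((N (b ∩ c) u : ℕ) : ℤ) = ∑ y ∈ link u, ind b y * ind c y := by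
    rw [N_inter, ← sum_boole]
    refine sum_congr rfl fun y _ => ?_
    by_cases hb : y ∈ b <;> by_cases hc : y ∈ c <;> simp [ind, hb, hc]
  have hNb : ((N b u : ℕ) : ℤ) = ∑ y ∈ link u, ind b y := by
    rw [N, ← sum_boole]; rfl
  have hNc : ((N c u : ℕ) : ℤ) = ∑ y ∈ link u, ind c y := by
    rw [N, ← sum_boole]; rfl
  have hL : ((Lam b c u : ℕ) : ℤ) = ∑ y ∈ link u, ind b y * ind c (anti u y) := by
    rw [Lam, ← sum_boole]
    refine sum_congr rfl fun y _ => ?_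
    by_cases hb : y ∈ b <;> by_cases hc : anti u y ∈ c <;> simp [ind, hb, hc]
  have h2 : ∑ y ∈ link u, (2 * (ind b u * ind c u) : ℤ) = 2 ^ (Fintype.card ι + 1) * (ind b u * ind c u) := by
    rw [sum_const, card_link, nsmul_eq_mul, pow_succ]; push_cast; ring
  rw [Phi, sum_add_distrib, sum_sub_distrib, sum_sub_distrib, sum_sub_distrib, h2, hNbc, hNb, hNc, hL, mul_sum, mul_sum]

end Summit.CriticalPhenomena.PercolationContinuityZ3.Theorems.SahiLatin
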